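import Summits.AnomalousDissipation.AnomalousDissipation.Theses.MomentParity
import Summits.AnomalousDissipation.AnomalousDissipation.Theorems.MomentParityResolvedDissipationEquivalently
import Literature.Analysis.FluidPDE.StatisticalSolutionEnergyEq

/-!
# Route MomentParity · crux `ResolvedDissipation` (stmt-AnomalousDissipation-14284) —
# S15 `stub_resolvedOfSSSEnergyEq`: the ensemble-currency leaf in Literature vocabulary

Supports stmt-AnomalousDissipation-14284 (line `enstrophy-ui-transfer`, skeleton v10, calibration stub S15;
no route-item statement is asserted — the crux stays open both ways).

The crux `ResolvedDissipation` (RD) is certified equivalent to the mean energy EQUALITY of Galerkin-limit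
stationary statistical solutions whose approximants live in a common ball (MEE,
`Equivalently.resolvedDissipation_iff_galerkinLimitEnergyEq`). This file states the sufficient condition in
the words of the literature the tree already vendors: the Literature statement
`Torus.IsStationaryStatisticalSolution.energy_eq` — the mean energy equation `ν ∫ ‖∇u‖² dμ = ∫ (f, u) dμ` of
a stationary statistical solution (FMRT 2001, Ch. IV Def. 1.3 with (1.29)–(1.31)), stated and PROVED in the
tree for `Fintype.card d = 2` (`IsStationaryStatisticalSolution.energy_eq_holds`, FMRT IV Thm. 2.2 / App. B.1)
and recorded in print as known in `d = 3` only as the inequality (1.31) (FMRT IV (1.31)–(1.33);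
Foias–Rosa–Temam, arXiv:1606.02174, §4 Def. 4.1 / Rem. 4.1) — taken at `d = 3`.

* `stub_resolvedOfSSSEnergyEq` (S15, registered verbatim): at fixed `ν > 0`, `f ∈ L²`, `R`, if every
  stationary statistical solution of NS(ν, f) carried by the ball `‖u‖ ≤ R` satisfies the mean energy
  equality, then ONE schedule resolves every admissible level-`N` law in that ball (RD at `(f, ν, R)`).
  Proof: K2a `TightExtraction.stub_tightExtraction` (Rellich–Prokhorov extraction with the lsc
  portmanteau, after the `N`-uniform budget `ensembleEnstrophy_le_of_isStationary`), K2b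
  `LimitSSS.stub_limitIsStationarySolution` (limits ARE stationary statistical solutions), the hypothesis,
  and K2c `Schedule.stub_scheduleOfLimitEnergyEq` (energy equality of all limits ⇒ one schedule).
* `resolvedDissipation_of_sssEnergyEq`: SSSEE₃ ⟹ `ResolvedDissipation` (crux BY NAME), SSSEE₃ := every
  stationary statistical solution of 3-D NS on `T³` with `ν > 0` and a smooth divergence-free mean-zero steady
  force satisfies the mean energy equality.
* `resolvedDissipation_of_energy_eq_three`: the same from the VERBATIM `d = 3` twin of the Literature
  statement `IsStationaryStatisticalSolution.energy_eq` (its binder shape, `hd` dropped, `d := Fin 3`).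
* `sssEnergyEq_two`: that binder shape HOLDS at `d = Fin 2` — the tree theorem `energy_eq_holds` — certifying
  that the hypothesis is stated in exactly the currency the tree's theorem concludes one dimension down.

So the conjecture-grade leaves of the crux are, with every arrow a tree theorem:
LHEE ⟹ GEE ⟹ GEE₀ᵃᵉ ⟺ TUI ⟹ U ⟺ RD ⟺ MEE ⟸ SSSEE₃ (this file); SSSEE₃ is the one named in print and typed in
Literature vocabulary.

References: Foias–Manley–Rosa–Temam, *Navier–Stokes Equations and Turbulence* (2001), Ch. IV Def. 1.3,
(1.29)–(1.33), Thm. 2.2, App. B.1; Foias–Rosa–Temam, J. Dyn. Diff. Eq. 31 (2019) (arXiv:1606.02174) §4.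
-/

noncomputable section

-- `Summit.<Summit>.<Problem>`: single-conjunct summit, the duplicate namespace segment is mandated.
set_option linter.dupNamespace false

namespace Summit.AnomalousDissipation.AnomalousDissipation.Theorems.MomentParityResolvedDissipation.SSSEnergyEq

open MeasureTheory Filter Topology
open scoped ENNReal NNReal InnerProductSpace RealInnerProductSpace
open Literature.Analysis.FunctionSpaces Literature.Analysis.FluidPDE
open Summit.AnomalousDissipation.AnomalousDissipation.Theses.MomentParity
open Summit.AnomalousDissipation.AnomalousDissipation.Theorems.QuarticGate.Negative
open Summit.AnomalousDissipation.AnomalousDissipation.Theorems.MomentParityResolvedDissipation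

/-! ## S15 — the registered stub -/

/-- **S15 · `stub_resolvedOfSSSEnergyEq` — mean energy equality of the stationary statistical solutions in a ball
⟹ the crux's conclusion at `(f, ν, R)`.** Fix `ν > 0`, `f ∈ L²` and `R`. If every stationary statistical solution
of NS(ν, f) on `T³` in the tree's sense (`Torus.IsStationaryStatisticalSolution`, FMRT IV Def. 1.3: probability on
`H`, finite mean enstrophy (1.29), Liouville equation (1.30), shell energy inequality (1.31)) that is carried by the
ball `‖u‖ ≤ R` satisfies the mean energy EQUALITY `ν ∫ ‖∇u‖² dμ = ∫ (u, f) dμ` (the `d = 3` twin of the Literature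
statement `IsStationaryStatisticalSolution.energy_eq`, a theorem for `d = 2`), then ONE schedule `κ` resolves the
mean enstrophy of every level-`N` admissible law in that ball. Proof: along any admissible sequence at levels
`N_i → ∞` the energy row bounds the mean enstrophies `N`-uniformly (`ensembleEnstrophy_le_of_isStationary`), so
K2a `TightExtraction.stub_tightExtraction` extracts a limit law in the ball, K2b
`LimitSSS.stub_limitIsStationarySolution` shows the limit IS a stationary statistical solution (finite enstrophy
included), the hypothesis gives its energy equality, and K2c `Schedule.stub_scheduleOfLimitEnergyEq` turns "every
admissible sequence has an energy-conserving limit" into a schedule. [folklore composition; FMRT 2001 Ch. IV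
Def. 1.3, (1.31)–(1.33), Thm. 2.2; arXiv:1606.02174 §4 Rem. 4.1] -/
theorem stub_resolvedOfSSSEnergyEq :
    ∀ (ν : ℝ), 0 < ν → ∀ (f : UnitAddTorus (Fin 3) → EuclideanSpace ℝ (Fin 3)), MemLp f 2 volume →
    ∀ R : ℝ,
      (∀ μ : Measure (Torus.energySpace (Fin 3)), Torus.IsStationaryStatisticalSolution ν f μ →
          (∀ᵐ u ∂μ, ‖u‖ ≤ R) →
          ν * (Torus.ensembleEnstrophy μ).toReal = ∫ u, Torus.pairing u.1 f ∂μ) →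
      ∃ κ : ℕ → ℕ, ∀ (N : ℕ) (μ : Measure (Torus.energySpace (Fin 3))), IsProbabilityMeasure μ →
        (∀ᵐ u ∂μ, IsLevel N u) → (∀ᵐ u ∂μ, ‖u‖ ≤ R) → (∀ d : ℕ, IsPolyStationary ν f N d μ) →
        ∀ n : ℕ, ∫⁻ u, Torus.eGradNormSq (u.1 : UnitAddTorus (Fin 3) → EuclideanSpace ℝ (Fin 3)) ∂μ ≤
          (∫⁻ u, Torus.eGradNormSq (Torus.fourierTruncate (κ n)
            (u.1 : UnitAddTorus (Fin 3) → EuclideanSpace ℝ (Fin 3))) ∂μ) + ((n : ℝ≥0∞) + 1)⁻¹ := by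
  intro ν hν f hf R hEE
  refine Schedule.stub_scheduleOfLimitEnergyEq ν f R hν hf fun Nl μ hp hl hb hs hN => ?_
  -- the `N`-uniform enstrophy budget of admissible laws (energy row)
  set M : ℝ≥0 := (Real.sqrt (∫ x, ‖f x‖ ^ 2) * R / ν).toNNReal with hM
  have hbudget : ∀ i, Torus.ensembleEnstrophy (μ i) ≤ M := by
    intro i
    haveI := hp i
    haveI : (ae (μ i)).NeBot := ae_neBot.2 (IsProbabilityMeasure.ne_zero (μ i))
    obtain ⟨u₀, hu₀⟩ := (hb i).exists
    have hR0 : 0 ≤ R := (norm_nonneg _).trans hu₀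
    have h := Theorems.ResolvedDissipation.Negative.ensembleEnstrophy_le_of_isStationary hν hf (hl i)
      hR0 (hb i) (fun m g P hg => hs i (P.totalDegree + 1) m g P hg le_rfl)
    rw [hM, ENNReal.ofReal] at *
    exact h
  -- K2a: extraction of a limit law in the ball
  obtain ⟨φ, hφ, μlim, hplim, hblim, hBC, hLSC, hTE, hPI⟩ :=
    TightExtraction.stub_tightExtraction R M μ hp hb hbudget
  -- K2b: the limit is a stationary statistical solution
  have hSSS : Torus.IsStationaryStatisticalSolution ν f μlim :=
    LimitSSS.stub_limitIsStationarySolution ν f R hν hf (fun i => Nl (φ i)) (fun i => μ (φ i))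
      (fun i => hp (φ i)) (fun i => hl (φ i)) (fun i => hb (φ i)) (fun i d => hs (φ i) d)
      (hN.comp hφ.tendsto_atTop) μlim hplim hblim hBC hLSC
  -- finite mean enstrophy is part of the definition; the energy equality is the hypothesis
  have hfin : Torus.ensembleEnstrophy μlim ≠ ⊤ := (lt_top_iff_ne_top).1 hSSS.enstrophy_finite
  exact ⟨φ, hφ, μlim, hfin, hEE μlim hSSS hblim, hPI f hf, hTE⟩

/-! ## SSSEE₃ ⟹ the crux, by name -/

/-- **SSSEE₃ ⟹ `ResolvedDissipation`.** If every stationary statistical solution (`Torus.IsStationaryStatisticalSolution`,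
FMRT IV Def. 1.3) of the 3-D Navier–Stokes equations on `T³` with viscosity `ν > 0` and a smooth divergence-free
mean-zero steady force satisfies the mean energy EQUALITY `ν ∫ ‖∇u‖² dμ = ∫ (u, f) dμ` — the statement printed as
open in dimension three (FMRT IV (1.31)–(1.33); arXiv:1606.02174 Rem. 4.1), the `d = 2` case being the tree theorem
`IsStationaryStatisticalSolution.energy_eq_holds` — then the crux `ResolvedDissipation` holds. From S15 at every
`(f, ν, R)` (`ResolvedDissipation` unfolds to its clauses; all-degree polynomial stationarity is the crux's clause
read degree by degree). The converse direction holds for the GALERKIN-LIMIT stationary statistical solutions in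
balls (`Equivalently.resolvedDissipation_iff_galerkinLimitEnergyEq`); nothing here proves or refutes the crux. -/
theorem resolvedDissipation_of_sssEnergyEq
    (hEE : ∀ (ν : ℝ), 0 < ν → ∀ (f : UnitAddTorus (Fin 3) → EuclideanSpace ℝ (Fin 3)),
      Torus.IsSmooth f → Torus.IsDivFree f → Torus.HasZeroMean f →
      ∀ μ : Measure (Torus.energySpace (Fin 3)), Torus.IsStationaryStatisticalSolution ν f μ →
        ν * (Torus.ensembleEnstrophy μ).toReal = ∫ u, Torus.pairing u.1 f ∂μ) :
    ResolvedDissipation := by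
  intro f hf hdiv hzero ν hν R
  obtain ⟨κ, hκ⟩ := stub_resolvedOfSSSEnergyEq ν hν f (hf.memLp 2) R
    (fun μ hμ _ => hEE ν hν f hf hdiv hzero μ hμ)
  refine ⟨κ, fun N μ hp hl hb hs n => hκ N μ hp hl hb ?_ n⟩
  intro d m g P hg _
  exact hs m g P hg

/-- **The verbatim `d = 3` twin of the Literature statement implies the crux.** The hypothesis is
`Torus.IsStationaryStatisticalSolution.energy_eq` with its dimension clause `hd : Fintype.card d = 2` dropped and
`d := Fin 3`: for every `ν`, every `f ∈ L²` and every stationary statistical solution `μ` of NS(ν, f) on `T³`,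
`ν ∫ ‖∇u‖² dμ = ∫ (u, f) dμ`. (FMRT 2001 IV (1.31)–(1.33): in dimension three only `≤` is known — the tree's
`IsStationaryStatisticalSolution.energy_le`.) -/
theorem resolvedDissipation_of_energy_eq_three
    (hEE₃ : ∀ {ν : ℝ} {f : UnitAddTorus (Fin 3) → EuclideanSpace ℝ (Fin 3)}
      {μ : Measure (Torus.energySpace (Fin 3))},
      Torus.IsStationaryStatisticalSolution ν f μ → MemLp f 2 volume →
        ν * (Torus.ensembleEnstrophy μ).toReal = ∫ u, Torus.pairing u.1 f ∂μ) :
    ResolvedDissipation :=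
  resolvedDissipation_of_sssEnergyEq fun _ν _hν _f hf _ _ _μ hμ => hEE₃ hμ (hf.memLp 2)

/-! ## Certificate: the same binder shape is a THEOREM one dimension down -/

/-- **The hypothesis shape of `resolvedDissipation_of_energy_eq_three` HOLDS at `d = Fin 2`**: every stationary
statistical solution of the 2-D Navier–Stokes equations on `T²` with an `L²` force satisfies the mean energy
equality — the tree theorem `Torus.IsStationaryStatisticalSolution.energy_eq_holds` (FMRT 2001 IV Thm. 2.2 with
App. B.1: the Galerkin-tested Liouville equation passes to the limit because the 2-D cutoff flux is dominated by the
enstrophy). So the conjecture-grade hypothesis above is stated in exactly the currency of a tree theorem, one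
dimension up. -/
theorem sssEnergyEq_two :
    ∀ {ν : ℝ} {f : UnitAddTorus (Fin 2) → EuclideanSpace ℝ (Fin 2)}
      {μ : Measure (Torus.energySpace (Fin 2))},
      Torus.IsStationaryStatisticalSolution ν f μ → MemLp f 2 volume →
        ν * (Torus.ensembleEnstrophy μ).toReal = ∫ u, Torus.pairing u.1 f ∂μ :=
  fun hμ hf => Torus.IsStationaryStatisticalSolution.energy_eq_holds (d := Fin 2) (by simp) hμ hf

end Summit.AnomalousDissipation.AnomalousDissipation.Theorems.MomentParityResolvedDissipation.SSSEnergyEq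

end
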